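import Literature.NumberTheory.EllipticCurves.LevelLoweringGamma0AtThree
import HarnessLib

/-!
# Level lowering AT THE PRIME `3` itself, in `Γ₀(N/3)`-newform currency, at `p = 3`
# (Mazur's principle / Ribet 1990 in Diamond 1995, Thm. 6.4 — the finite-at-`3`, split multiplicative case)

Topic `NumberTheory/EllipticCurves`; namespace `Literature.NumberTheory.EllipticCurves`. ONE named fact
(`def … : Prop`, nothing asserted, nothing admitted) + its `Iff.rfl` unfolding lemma, typed for the
`bsd-addord` cell (work item `wi-76751`; consumer
`stmt-BirchSwinnertonDyer-19679` `DeepLowerAtThreeOffKatoStratum`, stub `stub_nonAdditive`, road (b), whose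
`…KimAtThreeDeepLowerOffStratumLevelLoweringVatsalStabRows.stub_nonAdditive_semistable_of_vatsal_of_levelLoweredNewform`
takes a prime `q` of split multiplicative reduction with NO `q ≠ 3` binder). This file is the `q = 3` TWIN of
the tree's `ribet1990_levelLowering_gamma0_newform_at_three` (sibling module `LevelLoweringGamma0AtThree`,
the case `q ≠ 3`): same packaging — a weight-two `Γ₀(M)`-NEWFORM `g` of level `M = N/3` with
`a_ℓ(g) ≡ a_ℓ(f_E)` at EVERY prime `ℓ ≠ 3` and `a_3(g) ≡ 3 + 1`, congruences read in `ℚ̄₃ = PadicAlgCl 3`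
through a field isomorphism `ι : ℚ̄₃ ≃+* ℂ`; the PROVED theorem
`levelLowering_gamma0_newform_at_three_all_primes` (module `LevelLoweringGamma0AtThreeAllPrimes`) glues the
two facts into the sibling's statement with its binder `q ≠ 3` deleted, which is the `q`-uniform shape the
consumer instantiates.

## What is packaged, and why every clause is in print at `ℓ = p = 3`

For a SEMISTABLE elliptic curve `E/ℚ` (globally minimal model `W₀`, square-free conductor `N = 3M`, `3 ∤ M`)
with `ρ̄ = ρ̄_{E,3} : G_ℚ → GL₂(𝔽₃)` SURJECTIVE, SPLIT multiplicative reduction at `3`, `3 ∣ ord_3(Δ_E)`, and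
`3 ∤ ord_ℓ(Δ_E)` for every prime `ℓ ∣ M`:

1. (Tate curve) `ρ̄` is flat (= finite) at `3` iff `3 ∣ ord_3(Δ_E)`, and for `ℓ ≠ 3` it is unramified at `ℓ`
   iff `3 ∣ ord_ℓ(Δ_E)` [cite: Stevens1997OverviewFLT, §2, Thm. (2.11)]. Hence `ρ̄` is finite at `3` and
   ramified at every `ℓ ∣ M`, so Serre's prime-to-`3` conductor is `N(ρ̄) = ∏_{ℓ ∣ M} ℓ = M`
   [cite: Edixhoven1997, §1, (1.6.1)]. Moreover `ρ̄|_{D_3}` is `ψ₀`-SELMER with `ψ₀ = 1` (Diamond's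
   terminology, §6, the local types defined before Thm. 6.4): over `ℚ₃` the Tate curve gives
   `0 → μ₃ → E[3] → ℤ/3 → 0` in the split case, i.e. `ρ̄|_{D_3} ≅ (χ̄₃ ∗ ; 0 1)`; on the modular side this is
   Diamond's remark (§6, just before Thm. 6.4, from Wiles' Thm. 2) that for `k = 2`, `3 ∥ N` and
   `a_3(f_E) = +1` a unit, `ρ_{f_E}|_{D_3}` is `ψ₀`-Selmer with `ψ₀(Frob_3) = a_3(f_E) = 1`
   [cite: Diamond1995RefinedSerre, §6 (before Thm. 6.4)].
2. `ρ̄` is irreducible, modular (from the newform `f_E ∈ S₂(Γ₀(N))`), and — its image being all of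
   `GL₂(𝔽₃)`, of order `48 > 16` — not induced from a character of `G_{ℚ(√−3)}`. DIAMOND'S THEOREM 6.4 (the
   case `ℓ = 3` is explicitly included) [cite: Diamond1995RefinedSerre, Thm. 6.4 and Cor. 6.5], which
   packages RIBET'S level-lowering theorem [cite: Ribet1990, Thm. 1.1] (Diamond's Thm. 1.1, `ℓ` odd) with
   Carayol's lemma and Mazur's principle, gives a weight-two NEWFORM `g` of conductor `N_g ∣ 9·N(ρ̄)` with
   `ρ̄ ≅ ρ̄_g` and `det ρ_g = χ·χ₃`, `χ` of order prime to `3` — hence `χ = 1` (its reduction is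
   `det ρ̄ · χ̄₃⁻¹ = 1` and prime-to-`3` roots of unity inject mod `3`), i.e. `g ∈ S₂(Γ₀(N_g))`; and, `ρ̄|_{D_3}`
   being FINITE, «`f` can be chosen so that `ℓ` does not divide `N`»: `3 ∤ N_g`; the proof of Thm. 6.4 takes,
   in the finite case, `f = g ∈ S₂(Γ₁(N(ρ̄)))` ALREADY chosen with `α(a_3(g)) = ψ₀(Frob_3)` when `ρ̄|_{D_3}` is
   `ψ₀`-Selmer (the choice is «clear» here because `ρ̄|_{D_3}`, containing the ramified `χ̄₃`, is not a sum of
   two distinct unramified characters), and Cor. 6.5 records that ONE newform preserves all local types at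
   once (finite, resp. `ψ₀`-Selmer, at `3`; type A at `ℓ ∣ M`). The same lowering for square-free level,
   weight two, trivial character and every `p ≥ 3` is [cite: Edixhoven1997, Thm. 3.1] («if `ρ` is finite at
   `p`, it is modular of type `(N(ρ),2,1)`»), whose step at the prime `l = p = 3` is MAZUR'S Thm. 3.2.1 there
   (`l = 3 ≢ 1 (mod 3)`, `l ∥ N`, `ρ` finite at `p`).
3. The level is exactly `M`: `N(ρ̄) ∣ N_g` (conductor = level, [cite: Carayol1986, Thm. (A)]) and
   `N_g ∣ N(ρ̄)` (`3 ∤ N_g ∣ 9·N(ρ̄)`), so `N_g = N(ρ̄) = M`. (Contrary to the sibling there is no `3 ∥ N_g`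
   branch: `3 ∤ M`.)
4. The congruences `a_ℓ(g) ≡ a_ℓ(E)` modulo the chosen prime over `3`: at `ℓ ∤ 3N` both sides are
   `tr ρ̄(Frob_ℓ)`; at `ℓ ∣ M` both `a_ℓ = ±1` are the value at `Frob_ℓ` of the unramified character through
   which `G_{ℚ_ℓ}` acts on the UNIQUE unramified quotient line of `ρ̄|_{G_{ℚ_ℓ}}` (unique because `ρ̄` is
   ramified at `ℓ`) — local–global compatibility for `g` at `ℓ ∥ N_g` [cite: Carayol1986, Thm. (A)] and the
   Tate curve for `E` (equivalently: Diamond's Cor. 6.5, type A is preserved); at `ℓ = 3`: `3 ∤ N_g`,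
   `ρ̄_g|_{D_3} ≅ ρ̄|_{D_3}` is Selmer, so `a_3(g)` is a `3`-adic unit and `ρ̄|_{D_3}` is `ψ₀`-Selmer with
   `ψ₀(Frob_3) = a_3(g) mod λ` (Deligne's theorem, [cite: Edixhoven1997, §2, Thms. 2.5–2.6]; Diamond §6,
   remarks before Thm. 6.4),
   whence `a_3(g) ≡ ψ₀(Frob_3) = 1 = a_3(E) ≡ 3 + 1` — this is Thm. 6.4's displayed clause
   «`α(a_ℓ(f)) = ψ₀(Frob_ℓ)`». Replacing `g` by a `Gal(ℚ̄/ℚ)`-conjugate realises the congruences at the prime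
   over `3` singled out by any given `ι`.

PRINT vs. WORK ITEM: every clause requested by `wi-76751` is supported at `ℓ = p = 3` as displayed above;
nothing was dropped or weakened. Of the sibling's two `ord_ℓ(Δ)` side conditions, (F1) «`ρ̄` ramified at
every `ℓ ∣ M`» is kept verbatim (the binder `ℓ ≠ 3` of the sibling is vacuous here since `3 ∤ M` and is
omitted), and (F2) «`3 ∣ M → 3 ∤ ord_3(Δ)`» is replaced by the POSITIVE finiteness hypothesis
`3 ∣ ord_3(Δ)`, which is what makes the prime `3` removable from the level at all (if `ρ̄` is not finite at
`3` the optimal level keeps the prime `3`, [cite: Edixhoven1997, Thm. 3.1], second sentence). As for the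
sibling, the hypothesis-free form «a newform of level exactly `N/3` congruent to `f_E` at every `ℓ ≠ 3`» is
not a printed theorem and fails when `ρ̄` is unramified at some other `ℓ' ∥ N` (non-optimal level `N/3`;
Diamond–Taylor is for `p ≥ 5`).
-- TODO(general form): every `p ≥ 5` at `q = p` (flat at `p`), and the additive primes.

## References

* F. Diamond, *The refined conjecture of Serre*, in: Elliptic Curves, Modular Forms & Fermat's Last Theorem
  (Hong Kong 1993), International Press (1995) 22–37: Thm. 1.1, Cor. 1.2, Lemma 2.1/2.2 (Carayol's lemma),
  §6 (local types: finite, Selmer, `ψ₀`-Selmer; the Wiles Thm. 2 / Deligne–Fontaine remarks before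
  Thm. 6.4), Thm. 6.4, Cor. 6.5 (held scan: pp. 40, 43–44 of the volume's PDF). [Diamond1995RefinedSerre]
* K. A. Ribet, *On modular representations of Gal(ℚ̄/ℚ) arising from modular forms*, Invent. Math. 100
  (1990) 431–476, Thm. 1.1. [Ribet1990]
* B. Edixhoven, *Serre's conjecture*, in: Cornell–Silverman–Stevens (eds.), Modular Forms and Fermat's Last
  Theorem (Springer 1997), §1 ((1.6.1); finiteness at `p`, before Def. 1.7), Thms. 2.5–2.6, Thm. 3.1, Thm. 3.2.1
  (Mazur). [Edixhoven1997]
* G. Stevens, *An overview of the proof of Fermat's Last Theorem*, ibid., §2, Thm. (2.11) («`ρ̄_{E,p}` is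
  flat at `p ⟺ p ∣ ord_p(Δ_E)`», `E` semistable). [Stevens1997OverviewFLT]
* H. Carayol, Ann. Sci. ÉNS 19 (1986) 409–468, Thm. (A). [Carayol1986]
-/

noncomputable section

open scoped MatrixGroups ModularForm

open CongruenceSubgroup WeierstrassCurve Literature.NumberTheory.EllipticCurves.ModularForms

namespace Literature.NumberTheory.EllipticCurves

/-- **Level lowering at the prime `3` itself in `Γ₀(N/3)`-newform currency, `p = 3`, semistable case,
`ρ̄` finite at `3`** (Mazur's principle and Ribet 1990, Thm. 1.1, in the weight-two packaging of
Diamond 1995, Thm. 6.4 / Cor. 6.5 — the case `ℓ = 3` included under «not induced from `ℚ(√−3)`», automatic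
for surjective `ρ̄`; bullets «`ρ₀|_{D_ℓ}` finite ⇒ `ℓ ∤ N`» and «`ψ₀`-Selmer ⇒ `α(a_ℓ(f)) = ψ₀(Frob_ℓ)`» — with
Carayol's conductor = level and local–global compatibility; see the module docstring for the
clause-by-clause derivation). For a globally minimal `W₀/ℚ`, elliptic, with `ρ̄_{E,3}` SURJECTIVE,
square-free conductor `N = M·3`, `3 ∤ M`, of SPLIT multiplicative reduction at `3` with `3 ∣ ord_3(Δ)`
(`ρ̄` finite at `3`, [cite: Stevens1997OverviewFLT, Thm. (2.11)]), such that `3 ∤ ord_ℓ(Δ)` for every prime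
`ℓ ∣ M` (`ρ̄` ramified at the other bad primes): for the newform `f = D₀.f ∈ S₂(Γ₀(3M))` of `W₀` and every
field isomorphism `ι : ℚ̄₃ ≃+* ℂ` there is a NEWFORM `g ∈ S₂(Γ₀(M))` with `a_ℓ(g) ≡ a_ℓ(f)` for every prime
`ℓ ≠ 3` and `a_3(g) ≡ 3 + 1`, the congruences being modulo the maximal ideal of `𝒪_{ℚ̄₃}` after transport
by `ι⁻¹`. The `q = 3` twin of `ribet1990_levelLowering_gamma0_newform_at_three`.
[cite: Diamond1995RefinedSerre, Thm. 6.4 and Cor. 6.5] [cite: Ribet1990, Thm. 1.1]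
[cite: Edixhoven1997, Thm. 3.1 and Thm. 3.2.1] [cite: Stevens1997OverviewFLT, Thm. (2.11)]
[cite: Carayol1986, Thm. (A)] -/
def ribet1990_levelLowering_gamma0_newform_at_three_prime_three : Prop :=
  ∀ (W₀ : WeierstrassCurve ℚ) [W₀.IsElliptic] [W₀.IsGloballyMinimal],
    W₀.HasSurjectiveModNGaloisRep 3 →
    ∀ {M : ℕ} [NeZero M], ¬ 3 ∣ M → Squarefree M →
      M * 3 = W₀.conductorNorm ℤ →
      W₀.HasSplitMultiplicativeReductionAtPrime 3 →
      (3 : ℤ) ∣ padicValRat 3 W₀.Δ →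
      (∀ ℓ : ℕ, ℓ.Prime → ℓ ∣ M → ¬ (3 : ℤ) ∣ padicValRat ℓ W₀.Δ) →
      ∀ (D₀ : ModularParametrizationData W₀ (M * 3)) (ι : PadicAlgCl 3 ≃+* ℂ),
        ∃ g : CuspForm (Gamma0 M) 2, IsNewform0 g ∧
          (∀ ℓ : ℕ, ℓ.Prime → ℓ ≠ 3 → Valued.v (ι.symm (cuspCoeff D₀.f ℓ - cuspCoeff g ℓ)) < 1) ∧
          Valued.v (ι.symm (cuspCoeff g 3 - (3 + 1))) < 1

/-- Unfolding lemma (the fact is a `Prop`-valued definition; this is its statement).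
[cite: Diamond1995RefinedSerre, Thm. 6.4 and Cor. 6.5] [cite: Ribet1990, Thm. 1.1] -/
theorem ribet1990_levelLowering_gamma0_newform_at_three_prime_three_iff :
    ribet1990_levelLowering_gamma0_newform_at_three_prime_three ↔
      ∀ (W₀ : WeierstrassCurve ℚ) [W₀.IsElliptic] [W₀.IsGloballyMinimal],
        W₀.HasSurjectiveModNGaloisRep 3 →
        ∀ {M : ℕ} [NeZero M], ¬ 3 ∣ M → Squarefree M →
          M * 3 = W₀.conductorNorm ℤ →
          W₀.HasSplitMultiplicativeReductionAtPrime 3 →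
          (3 : ℤ) ∣ padicValRat 3 W₀.Δ →
          (∀ ℓ : ℕ, ℓ.Prime → ℓ ∣ M → ¬ (3 : ℤ) ∣ padicValRat ℓ W₀.Δ) →
          ∀ (D₀ : ModularParametrizationData W₀ (M * 3)) (ι : PadicAlgCl 3 ≃+* ℂ),
            ∃ g : CuspForm (Gamma0 M) 2, IsNewform0 g ∧
              (∀ ℓ : ℕ, ℓ.Prime → ℓ ≠ 3 → Valued.v (ι.symm (cuspCoeff D₀.f ℓ - cuspCoeff g ℓ)) < 1) ∧
              Valued.v (ι.symm (cuspCoeff g 3 - (3 + 1))) < 1 :=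
  Iff.rfl

end Literature.NumberTheory.EllipticCurves

end
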